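import Summits.Ventures.Crystal3D.Theorems.StickyWulffConstantGenericWallFloorRigidRung
import Summits.Ventures.Crystal3D.Theorems.StickyWulffConstantGenericWallFloorNonSaturation
import HarnessLib

/-!
# The rigid-bicrystal rung of `stub_twoSlabAdhesion` for DISJOINT non-co-axial pairs — unconditional

HONEST FRAMING. Part of the venture `Summits/Ventures/Crystal3D` (cell `crystal3d-full`), helper
`--supports` the crux `GenericWallFloor` (stmt-Ventures-19480, `route-Ventures-StickyWulffConstant`),
REGISTERED line `WallLedgerG`, stub `stub_twoSlabAdhesion`.  This file is a RUNG, not the stub.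
It discharges the LOCAL NON-SATURATION hypotheses of prover 19480-p1's `rigid_twoSlabAdhesion`
(`…GenericWallFloorRigidRung`) by the kernel theorem `nonsaturation_offCoincidence` (module M5,
`…GenericWallFloorNonSaturation`): under that rung's standing hypothesis `Λ₁ ∩ Λ₂ = ∅` every grain
ball is a non-coincidence site, so for a NON-CO-AXIAL pair (the hypothesis of `TwoSlabAdhesion`
verbatim) every grain ball with an empty slot has at most eleven contacts — no certified computation,
no extra hypothesis.

**Theorem (`rigid_twoSlabAdhesion_of_not_coaxial`).**  Let `Λ₁ = A₁·Λ₀ + t₁`, `Λ₂ = A₂·Λ₀ + t₂` be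
NOT co-axial and DISJOINT (`Λ₁ ∩ Λ₂ = ∅`: no coincidence site — automatic unless the pair is an exact
CSL pair with a coincidence-compatible offset).  Then there are `C` and `R₀ = 3` such that in every
clamped cylinder cell of `TwoSlabAdhesion` whose filling is RIGID (every ball on `Λ₁` or `Λ₂`) with
CLEAN outer slivers (balls below `−2R₀ + 1` on `Λ₁`, above `h + 2R₀ − 1` on `Λ₂`) the stub's inequality
holds:  `cross(P₁, X ∖ P₁) + cross(P₂, Y) ≤ D(Y) + (φ₁ + φ₂ − 1) π ρ² + C (1 + h) ρ`.

WHAT THIS IS NOT: pairs WITH coincidence sites (CSL offsets; needs M7), non-rigid fillings (the crux),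
the clean-sliver hypothesis removed; rung F-C1 not moved.
-/

noncomputable section

namespace Summit.Ventures.Crystal3D.Theorems

open Summit.Ventures.Crystal3D Finset
open Literature.MathematicalPhysics.StatisticalMechanics (fccStacking barlowStacking IsHaggSeq
  orderedContacts contactDeficiency)
open scoped InnerProductSpace

open scoped Classical in
/-- **Local non-saturation, discharged** (one grain of a disjoint non-co-axial rigid bicrystal): every
ball of `X` on `Λ₁` with an empty slot `x + A₁ u ∉ X` has at most eleven contacts. -/
theorem unsat_of_disjoint_not_coaxial
    (A₁ : EuclideanSpace ℝ (Fin 3) ≃ₗᵢ[ℝ] EuclideanSpace ℝ (Fin 3)) (t₁ : EuclideanSpace ℝ (Fin 3))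
    (A₂ : EuclideanSpace ℝ (Fin 3) ≃ₗᵢ[ℝ] EuclideanSpace ℝ (Fin 3)) (t₂ : EuclideanSpace ℝ (Fin 3))
    (hnc : ¬ ∃ (L : EuclideanSpace ℝ (Fin 3) ≃ₗᵢ[ℝ] EuclideanSpace ℝ (Fin 3))
        (s₁ s₂ : EuclideanSpace ℝ (Fin 3)) (σ σ' : ℤ → ℤ), IsHaggSeq σ ∧ IsHaggSeq σ' ∧
        (fun x => A₁ x + t₁) '' fccStacking 1 (Real.sqrt (2 / 3)) ⊆
          (fun x => L x + s₁) '' barlowStacking 1 (Real.sqrt (2 / 3)) σ ∧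
        (fun x => A₂ x + t₂) '' fccStacking 1 (Real.sqrt (2 / 3)) ⊆
          (fun x => L x + s₂) '' barlowStacking 1 (Real.sqrt (2 / 3)) σ')
    (hdisj : ∀ p ∈ (fun q => A₁ q + t₁) '' fccStacking 1 (Real.sqrt (2 / 3)),
      p ∉ (fun q => A₂ q + t₂) '' fccStacking 1 (Real.sqrt (2 / 3)))
    (X : Finset (EuclideanSpace ℝ (Fin 3))) (hX : ∀ p ∈ X, ∀ q ∈ X, p ≠ q → 1 ≤ dist p q)
    (hrigid : ∀ x ∈ X, x ∈ (fun q => A₁ q + t₁) '' fccStacking 1 (Real.sqrt (2 / 3)) ∨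
      x ∈ (fun q => A₂ q + t₂) '' fccStacking 1 (Real.sqrt (2 / 3))) :
    ∀ u ∈ fccSlots, ∀ x ∈ X, x ∈ (fun q => A₁ q + t₁) '' fccStacking 1 (Real.sqrt (2 / 3)) →
      x + A₁ u ∉ X → (X.filter fun q => dist x q = 1).card ≤ 11 := by
  classical
  intro u hu x hxX hx₁ hup
  refine nonsaturation_offCoincidence A₁ A₂ t₁ t₂ x X hnc hx₁ (hdisj x hx₁) hX ?_ ?_
  · intro q hq hd hq₁
    exact (hrigid q hq).resolve_left hq₁
  · exact Finset.card_pos.2 ⟨u, mem_filter.2 ⟨hu, hup⟩⟩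

open scoped Classical in
/-- **The rigid rung for disjoint non-co-axial pairs (unconditional).**  See the module docstring:
`rigid_twoSlabAdhesion` with both non-saturation hypotheses discharged by
`nonsaturation_offCoincidence`. -/
theorem rigid_twoSlabAdhesion_of_not_coaxial
    (A₁ : EuclideanSpace ℝ (Fin 3) ≃ₗᵢ[ℝ] EuclideanSpace ℝ (Fin 3)) (t₁ : EuclideanSpace ℝ (Fin 3))
    (A₂ : EuclideanSpace ℝ (Fin 3) ≃ₗᵢ[ℝ] EuclideanSpace ℝ (Fin 3)) (t₂ : EuclideanSpace ℝ (Fin 3))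
    (hnc : ¬ ∃ (L : EuclideanSpace ℝ (Fin 3) ≃ₗᵢ[ℝ] EuclideanSpace ℝ (Fin 3))
        (s₁ s₂ : EuclideanSpace ℝ (Fin 3)) (σ σ' : ℤ → ℤ), IsHaggSeq σ ∧ IsHaggSeq σ' ∧
        (fun x => A₁ x + t₁) '' fccStacking 1 (Real.sqrt (2 / 3)) ⊆
          (fun x => L x + s₁) '' barlowStacking 1 (Real.sqrt (2 / 3)) σ ∧
        (fun x => A₂ x + t₂) '' fccStacking 1 (Real.sqrt (2 / 3)) ⊆
          (fun x => L x + s₂) '' barlowStacking 1 (Real.sqrt (2 / 3)) σ')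
    (hdisj : ∀ p ∈ (fun q => A₁ q + t₁) '' fccStacking 1 (Real.sqrt (2 / 3)),
      p ∉ (fun q => A₂ q + t₂) '' fccStacking 1 (Real.sqrt (2 / 3))) :
    ∃ C R₀ : ℝ, 1 ≤ R₀ ∧ ∀ h : ℝ, 0 ≤ h → ∀ ρ : ℝ, R₀ ≤ ρ →
      ∀ X P₁ P₂ : Finset (EuclideanSpace ℝ (Fin 3)),
      (∀ p ∈ X, ∀ q ∈ X, p ≠ q → 1 ≤ dist p q) → P₁ ⊆ X → P₂ ⊆ X \ P₁ →
      (∀ p ∈ X, -(2 * R₀) ≤ p 2 ∧ p 2 ≤ h + 2 * R₀ ∧ p 0 ^ 2 + p 1 ^ 2 ≤ ρ ^ 2) →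
      (∀ p, p ∈ P₁ ↔ (p ∈ (fun q => A₁ q + t₁) '' fccStacking 1 (Real.sqrt (2 / 3)) ∧
        -(2 * R₀) ≤ p 2 ∧ p 2 ≤ -R₀ ∧ p 0 ^ 2 + p 1 ^ 2 ≤ ρ ^ 2)) →
      (∀ p, p ∈ P₂ ↔ (p ∈ (fun q => A₂ q + t₂) '' fccStacking 1 (Real.sqrt (2 / 3)) ∧
        h + R₀ ≤ p 2 ∧ p 2 ≤ h + 2 * R₀ ∧ p 0 ^ 2 + p 1 ^ 2 ≤ ρ ^ 2)) →
      -- RIGID filling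
      (∀ x ∈ X, x ∈ (fun q => A₁ q + t₁) '' fccStacking 1 (Real.sqrt (2 / 3)) ∨
        x ∈ (fun q => A₂ q + t₂) '' fccStacking 1 (Real.sqrt (2 / 3))) →
      -- CLEAN outer slivers
      (∀ p ∈ X, p 2 < -(2 * R₀) + 1 → p ∈ (fun q => A₁ q + t₁) '' fccStacking 1 (Real.sqrt (2 / 3))) →
      (∀ p ∈ X, h + 2 * R₀ - 1 < p 2 → p ∈ (fun q => A₂ q + t₂) '' fccStacking 1 (Real.sqrt (2 / 3))) →
      ((((P₁ ×ˢ (X \ P₁)).filter fun pq => dist pq.1 pq.2 = 1).card : ℕ) : ℝ) +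
        ((((P₂ ×ˢ ((X \ P₁) \ P₂)).filter fun pq => dist pq.1 pq.2 = 1).card : ℕ) : ℝ) ≤
        contactDeficiency ((X \ P₁) \ P₂) +
          (Real.sqrt 2 / 4 * ∑ᶠ w ∈ {w ∈ fccStacking 1 (Real.sqrt (2 / 3)) | ‖w‖ = 1},
              |⟪w, A₁.symm (EuclideanSpace.single (2 : Fin 3) (1 : ℝ))⟫_ℝ| +
            Real.sqrt 2 / 4 * ∑ᶠ w ∈ {w ∈ fccStacking 1 (Real.sqrt (2 / 3)) | ‖w‖ = 1},
              |⟪w, A₂.symm (EuclideanSpace.single (2 : Fin 3) (1 : ℝ))⟫_ℝ| - 1) * Real.pi * ρ ^ 2 +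
          C * (1 + h) * ρ := by
  classical
  obtain ⟨C, R₀, hR₀, H⟩ := rigid_twoSlabAdhesion A₁ t₁ A₂ t₂ hdisj
  refine ⟨C, R₀, hR₀, ?_⟩
  intro h hh ρ hρ X P₁ P₂ hX hP₁X hP₂X hcell hP₁ hP₂ hrigid hclean₁ hclean₂
  -- the symmetric data for the second grain
  have hnc' : ¬ ∃ (L : EuclideanSpace ℝ (Fin 3) ≃ₗᵢ[ℝ] EuclideanSpace ℝ (Fin 3))
      (s₁ s₂ : EuclideanSpace ℝ (Fin 3)) (σ σ' : ℤ → ℤ), IsHaggSeq σ ∧ IsHaggSeq σ' ∧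
      (fun x => A₂ x + t₂) '' fccStacking 1 (Real.sqrt (2 / 3)) ⊆
        (fun x => L x + s₁) '' barlowStacking 1 (Real.sqrt (2 / 3)) σ ∧
      (fun x => A₁ x + t₁) '' fccStacking 1 (Real.sqrt (2 / 3)) ⊆
        (fun x => L x + s₂) '' barlowStacking 1 (Real.sqrt (2 / 3)) σ' := by
    rintro ⟨L, s₁, s₂, σ, σ', hσ, hσ', h2, h1⟩
    exact hnc ⟨L, s₂, s₁, σ', σ, hσ', hσ, h1, h2⟩
  have hdisj' : ∀ p ∈ (fun q => A₂ q + t₂) '' fccStacking 1 (Real.sqrt (2 / 3)),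
      p ∉ (fun q => A₁ q + t₁) '' fccStacking 1 (Real.sqrt (2 / 3)) := fun p hp₂ hp₁ => hdisj p hp₁ hp₂
  have hrigid' : ∀ x ∈ X, x ∈ (fun q => A₂ q + t₂) '' fccStacking 1 (Real.sqrt (2 / 3)) ∨
      x ∈ (fun q => A₁ q + t₁) '' fccStacking 1 (Real.sqrt (2 / 3)) := fun x hx => (hrigid x hx).symm
  have h₁ := unsat_of_disjoint_not_coaxial A₁ t₁ A₂ t₂ hnc hdisj X hX hrigid
  have h₂ := unsat_of_disjoint_not_coaxial A₂ t₂ A₁ t₁ hnc' hdisj' X hX hrigid'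
  exact H h hh ρ hρ X P₁ P₂ hX hP₁X hP₂X hcell hP₁ hP₂ hrigid hclean₁ hclean₂
    (fun u hu x hx hx₁ hup _ _ => h₁ u hu x hx hx₁ hup)
    (fun u hu x hx hx₂ hup _ _ => h₂ u hu x hx hx₂ hup)

end Summit.Ventures.Crystal3D.Theorems

end
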